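import Mathlib
import HarnessLib
import Summits.NavierStokesRegularity.NavierStokesRegularity.Theses.PoloidalWindowDoor
import Summits.NavierStokesRegularity.NavierStokesRegularity.Theorems.LocalSineTubeDoorMostTimesGenericDoor

/-!
# Route `PoloidalWindowDoor` (rung N0-LocalTubeDoorPoloidal) — the MOST-TIMES form of the leaf, CONDITIONAL on the crux K2

Cell ns-regularity-ideate, seat p6 (route-directed support; anchor `--supports stmt-NavierStokesRegularity-19707`, the
route's Target).  The route's certified `closes` derives the leaf `Target` (fading of `∫_U ⟪(T−t) curl u, e⟫² dy` as
`t → T⁻` through ALL times ⇒ backward bounded) from K1 (proved) and K2 `PoloidalWindowRigidity` (OPEN, the lead's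
crux).  With the most-times template `…MostTimesGenericDoor.mostTimesGenericDoor_of_profileWindowRigidity` the SAME crux
K2 yields the stronger MOST-TIMES leaf: fading only along times outside an exceptional set of density `→ 0` at `T`
suffices (`mostTimesPoloidalDoor_of_poloidalWindowRigidity`).  So closing K2 closes both forms; nothing here touches K2.

WHAT THIS IS NOT: not a claim about Navier–Stokes regularity (Clay A) and not progress on K2 — a conditional
strengthening of the rung leaf (a LOCAL criterion conditional on local Type I AND on the open crux K2), bears_on
LADDER-NS N0, rung N0-LocalTubeDoorPoloidal.
-/

noncomputable section

-- the summit and its single sub-problem share the name (CONVENTIONS §1), as in every Theorems file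
set_option linter.dupNamespace false

namespace Summit.NavierStokesRegularity.NavierStokesRegularity.Theorems.PoloidalWindowDoorMostTimesDoor

open MeasureTheory Set Function Filter Topology TopologicalSpace Metric
open scoped RealInnerProductSpace InnerProductSpace NNReal ENNReal
open Literature.Analysis Literature.Analysis.FluidPDE
open Summit.NavierStokesRegularity.NavierStokesRegularity.Theorems.LocalSineTubeDoorMostTimesGenericDoor

/-- `F(x, A) = ⟪curlCLM A, e⟫²` is continuous. -/
theorem continuous_curlCompSq (e : EuclideanSpace ℝ (Fin 3)) :
    Continuous fun q : EuclideanSpace ℝ (Fin 3) × (EuclideanSpace ℝ (Fin 3) →L[ℝ] EuclideanSpace ℝ (Fin 3)) =>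
      ⟪curlCLM q.2, e⟫_ℝ ^ 2 :=
  ((curlCLM.continuous.comp continuous_snd).inner continuous_const).pow 2

/-- The zero set of `F(x, A) = ⟪curlCLM A, e⟫²` is invariant under positive rescalings. -/
theorem curlCompSq_zeroSet_invariant (e : EuclideanSpace ℝ (Fin 3)) :
    ∀ (a b : ℝ), 0 < a → 0 < b → ∀ (x : EuclideanSpace ℝ (Fin 3))
      (A : EuclideanSpace ℝ (Fin 3) →L[ℝ] EuclideanSpace ℝ (Fin 3)),
      ⟪curlCLM (b • A), e⟫_ℝ ^ 2 = 0 ↔ ⟪curlCLM A, e⟫_ℝ ^ 2 = 0 := by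
  intro a b _ hb x A
  rw [map_smul, real_inner_smul_left, mul_pow, mul_eq_zero, or_iff_right (pow_ne_zero 2 hb.ne')]

/-- **THE MOST-TIMES POLOIDAL DOOR ⇐ K2.**  If the route's crux `PoloidalWindowRigidity` holds, then for a classical
Leray–Hopf solution on `[0,T)` from rapidly decaying data, LOCALLY Type I at `(x₀,T)`, a nonempty open window `U`,
`e ≠ 0`, and an exceptional time set `E` with `|E ∩ (T−h,T)| ≤ εh` for all small `h` (every `ε > 0`): if
`∫_U ⟪(T−tₖ) curl u(tₖ, x₀+√(T−tₖ)y), e⟫² dy → 0` along EVERY sequence `tₖ → T` in `[0,T) ∖ E`, then `u` is backward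
bounded at `x₀`. -/
theorem mostTimesPoloidalDoor_of_poloidalWindowRigidity
    (hK2 : Summit.NavierStokesRegularity.NavierStokesRegularity.Theses.PoloidalWindowDoor.PoloidalWindowRigidity) :
    ∀ (ν T : ℝ), 0 < ν → 0 < T → ∀ (u : ℝ → EuclideanSpace ℝ (Fin 3) → EuclideanSpace ℝ (Fin 3))
      (p : ℝ → EuclideanSpace ℝ (Fin 3) → ℝ),
    Literature.Analysis.FluidPDE.IsClassicalNSSolutionOn (Set.Ico 0 T) ν 0 u p →
    Literature.Analysis.FluidPDE.IsLerayHopfOn T ν 0 (u 0) u →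
    Literature.Analysis.FluidPDE.HasRapidSpatialDecay (u 0) →
    ∀ (x₀ : EuclideanSpace ℝ (Fin 3)) (ρ M : ℝ), 0 < ρ →
    (∀ t ∈ Set.Ico 0 T, T - ρ ^ 2 < t → ∀ x ∈ Metric.ball x₀ ρ, ‖u t x‖ * Real.sqrt (ν * (T - t)) ≤ M) →
    ∀ (U : Set (EuclideanSpace ℝ (Fin 3))), IsOpen U → U.Nonempty →
    ∀ (e : EuclideanSpace ℝ (Fin 3)), e ≠ 0 →
    ∀ (E : Set ℝ), (∀ ε > 0, ∀ᶠ h in nhdsWithin (0 : ℝ) (Set.Ioi 0),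
      MeasureTheory.volume (E ∩ Set.Ioo (T - h) T) ≤ ENNReal.ofReal (ε * h)) →
    (∀ t : ℕ → ℝ, (∀ k, t k ∈ Set.Ico 0 T ∧ t k ∉ E) → Filter.Tendsto t Filter.atTop (nhds T) →
      Filter.Tendsto (fun k => ∫⁻ y in U, ENNReal.ofReal
        (⟪(T - t k) • Literature.Analysis.FluidPDE.curl (u (t k)) (x₀ + Real.sqrt (T - t k) • y), e⟫_ℝ ^ 2))
        Filter.atTop (nhds 0)) →
    Literature.Analysis.FluidPDE.IsBackwardBoundedAt u T x₀ := by
  intro ν T hν hT u p hsol hLH hdec x₀ ρ M hρ hM U hU hUne e he E hE hfadeE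
  have hcrux : ∀ (C : ℝ) (v : ℝ → EuclideanSpace ℝ (Fin 3) → EuclideanSpace ℝ (Fin 3)),
      Literature.Analysis.FluidPDE.HasTypeITimeDecay C v →
      ContinuousOn (Function.uncurry v) (Set.Iio (0 : ℝ) ×ˢ Set.univ) →
      (∀ s t : ℝ, s < t → t < 0 → ∀ x, v t x =
        Literature.Analysis.UnboundedOperators.heatExtension (v s) (t - s) x -
          Literature.Analysis.FluidPDE.oseenDuhamel 1 s v v t x) →
      (∀ t < 0, Literature.Analysis.FluidPDE.VectorCalculus.IsDivFree (v t)) →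
      (∀ s < 0, ∃ U : Set (EuclideanSpace ℝ (Fin 3)), IsOpen U ∧ U.Nonempty ∧
        ∀ z ∈ U, (fun (_ : EuclideanSpace ℝ (Fin 3)) (A : EuclideanSpace ℝ (Fin 3) →L[ℝ] EuclideanSpace ℝ (Fin 3)) =>
          ⟪curlCLM A, e⟫_ℝ ^ 2) (v s z) (fderiv ℝ (v s) z) = 0) →
      ¬ Literature.Analysis.FluidPDE.IsBackwardSingularPoint v 0 := by
    intro C v hrate hcont hmild hdiv hwin
    refine (hK2 C v hrate hcont hmild hdiv).2 e he fun s hs => ?_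
    obtain ⟨U', hU', hne', hal⟩ := hwin s hs
    refine ⟨U', hU', hne', fun y hy => ?_⟩
    have h := hal y hy
    simp only [sq_eq_zero_iff] at h
    rwa [← curl_eq_curlCLM] at h
  refine mostTimesGenericDoor_of_profileWindowRigidity (fun _ A => ⟪curlCLM A, e⟫_ℝ ^ 2) (continuous_curlCompSq e)
    (curlCompSq_zeroSet_invariant e) hcrux ν T hν hT u p hsol hLH hdec x₀ ρ M hρ hM U hU hUne E hE
    fun t htk htT => ?_
  refine (hfadeE t htk htT).congr fun k => ?_
  refine lintegral_congr fun y => ?_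
  have hs : 0 ≤ T - t k := (sub_pos.2 (htk k).1.2).le
  rw [map_smul, ← curl_eq_curlCLM, Real.sq_sqrt hs, abs_of_nonneg (sq_nonneg _)]

end Summit.NavierStokesRegularity.NavierStokesRegularity.Theorems.PoloidalWindowDoorMostTimesDoor

end
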